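import Summits.AtomisticToContinuum.BoseEinsteinCondensation.Theorems.BECDyadicChainingBaseCoherentMassFreeBase
import Summits.AtomisticToContinuum.BoseEinsteinCondensation.Theorems.BECDyadicChainingBaseCoherentMassSineGap
import Summits.AtomisticToContinuum.BoseEinsteinCondensation.Theorems.BECDyadicChainingBaseCoherentMassFreeUpperBound
import Summits.AtomisticToContinuum.BoseEinsteinCondensation.Theorems.BECDyadicChainingDyadicCoherenceDefectZeroScatteringEnergy
import HarnessLib

/-!
# Crux `BECTangentRigidity.TangentTransfer` (stmt-AtomisticToContinuum-13033), line `registered` (v2):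
# STUB `stub_freeCoarse` — coarse coherence at level `0` for zero scattering length

For every repulsive finite-range pair potential `v` with `scatteringLength v = 0` and every density
`ρ > 0`: eventually in `N`, with `L = (N/ρ)^{1/3}`, there is `δ > 0` such that every `δ`-near-minimiser
`Ψ` of the Dirichlet energy in the box of side `L` has at least `N/2` particles in the flat mode of the
whole box, `ofReal (N/2) ≤ cohSum N L 0 Ψ`.

Proof.
* Zero scattering length means no interaction (`stub_zeroScatteringEnergy` of route BECDyadicChaining,
  proved: `v(|x|) = 0` for a.e. `x` by `LSSY2005_zeroScatteringLength_holds`), so `energy v = energy 0`,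
  `E₀(v) = E₀(0)`, and the claim is about the FREE Dirichlet gas.
* `condensation_of_nearMin_eps` (the proved `condensation_of_nearMin` with the slack `1/100` replaced
  by a parameter `ε`): the one-body sine gap (`stub_sineGap`) integrated over the one-particle slices
  and the sharp upper bound `E₀(0,N,L) ≤ 3π²N/L²` (`stub_freeUpperBound`) put all but `εN` particles
  of a `δ`-near-minimiser, `δ = ε·3π²N/L²`, into the sine mode `s = ∏ₖ √(2/L) sin(πxₖ/L)`.
* `cohSum_ge_of_condensation` (the proved `base_of_condensation` run to the coherent SUM instead of
  the coherent amplitude): in Gram-vector language (`u_φ(Y) = ∫ conj(φ) Ψ(·,Y)`,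
  `⟨φ, γ_Ψ φ⟩ = N‖u_φ‖²`), `u_B = α_B u_s + w_B` for the flat modes `φ_B` of level `K` with
  `∑_B ‖w_B‖² ≤ ε` (Bessel + Pythagoras per slice, `slice_error_le`), Minkowski in `L²(dY)` and
  Cauchy–Schwarz over the `8^K` cells give `∑_B ‖u_B‖ ≥ 8^{K/2}(κ₀(1-ε) - √ε)` whenever
  `∑_B α_B ≥ κ₀ 8^{K/2}`, and Cauchy–Schwarz once more gives `cohSum_K ≥ (κ₀(1-ε) - √ε)² N`.
* The overlap constant of the sine mode is `(2√2/π)³ ≥ 18/25` (`sineMode_overlap_ge'`, `π < 3.15`),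
  and with `√ε = 10⁻³`: `(18/25·(1 - 10⁻⁶) - 10⁻³)² = 0.5169… ≥ 1/2`.

References: E. H. Lieb, R. Seiringer, J. P. Solovej, J. Yngvason, *The Mathematics of the Bose Gas
and its Condensation* (2005), §1.2 (1.17), App. C Thm. C.1; the Hilbert-space bookkeeping is folklore.
-/

noncomputable section

open MeasureTheory Filter Set
open scoped ENNReal NNReal Topology BigOperators

/-! ## Free-gas lemmas with a free slack parameter (namespace of the free base) -/

namespace Summit.AtomisticToContinuum.BoseEinsteinCondensation.Theorems.BaseCoherentMass

open scoped ComplexConjugate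
open Literature.MathematicalPhysics.QuantumManyBody.BoseGas

/-- **Condensation of free near-minimisers, with a free slack `ε`.** If the one-body gap holds in the
form `6‖f‖² ≤ (L/π)²‖∇f‖² + 3|∫ s f|²` for `C¹` functions vanishing off the box, and
`E₀(0, N, L) ≤ 3π²N/L²`, then every `Ψ` with `energy 0 Ψ ≤ E₀ + ε·3π²N/L²` has
`1 ≤ ε + ∫ |∫ s(x)Ψ(x,Y) dx|² dY`, i.e. `⟨s, γ_Ψ s⟩ ≥ (1-ε) N` (gap integrated over the slices,
`T = N ∫|∇₀Ψ|²` by Bose symmetry).  The case `ε = 1/100` is `condensation_of_nearMin`, whose proof is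
repeated verbatim. [cite: LSSY2005, §1.2 (1.17)] -/
theorem condensation_of_nearMin_eps {L : ℝ} {n : ℕ} {s : Space → ℝ} (hsc : Continuous s) (ε : ℝ)
    (hGap : ∀ f : Space → ℂ, ContDiff ℝ 1 f → (∀ x, x ∉ box L → f x = 0) →
      6 * ∫⁻ x, (‖f x‖₊ : ℝ≥0∞) ^ 2 ≤
        ENNReal.ofReal ((L / Real.pi) ^ 2) * (∫⁻ x, gradSqC f x) +
          3 * (‖∫ x, (s x : ℂ) * f x‖₊ : ℝ≥0∞) ^ 2)
    (hUpper : groundStateEnergy 0 (n + 1) L ≤ ENNReal.ofReal (3 * Real.pi ^ 2 / L ^ 2 * ((n + 1 : ℕ) : ℝ)))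
    (Ψ : TrialState (n + 1) L)
    (hΨ : energy 0 Ψ ≤ groundStateEnergy 0 (n + 1) L +
      ENNReal.ofReal (3 * Real.pi ^ 2 / L ^ 2 * (((n + 1 : ℕ) : ℝ) * ε))) :
    1 ≤ ENNReal.ofReal ε +
      ∫⁻ Y : Config n, (‖∫ x, (s x : ℂ) * Ψ.ψ (Matrix.vecCons x Y)‖₊ : ℝ≥0∞) ^ 2 := by
  -- adapted from `condensation_of_nearMin` (`Theorems/BECDyadicChainingBaseCoherentMassFreeBase.lean`)
  have hL : 0 < L := by
    by_contra hL
    have h0 : ∀ X, Ψ.ψ X = 0 := fun X => Ψ.eq_zero X fun hX => hL ((hX 0 0).1.trans (hX 0 0).2)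
    have h1 := Ψ.norm_eq
    simp [h0] at h1
  have hcont : Continuous Ψ.ψ := Ψ.contDiff.continuous
  have hdiff : Differentiable ℝ Ψ.ψ := Ψ.contDiff.differentiable one_ne_zero
  have hmeas : Measurable Ψ.ψ := hcont.measurable
  set T : ℝ≥0∞ := ∫⁻ Y : Config n, (‖∫ x, (s x : ℂ) * Ψ.ψ (Matrix.vecCons x Y)‖₊ : ℝ≥0∞) ^ 2 with hT
  -- the gap on each slice
  have hY : ∀ Y : Config n, 6 * ∫⁻ x, (‖Ψ.ψ (Matrix.vecCons x Y)‖₊ : ℝ≥0∞) ^ 2 ≤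
      ENNReal.ofReal ((L / Real.pi) ^ 2) * (∫⁻ x, gradSqC (fun y => Ψ.ψ (Matrix.vecCons y Y)) x) +
        3 * (‖∫ x, (s x : ℂ) * Ψ.ψ (Matrix.vecCons x Y)‖₊ : ℝ≥0∞) ^ 2 := fun Y =>
    hGap (fun y => Ψ.ψ (Matrix.vecCons y Y)) (contDiff_vecCons_slice Ψ.contDiff Y)
      (fun x hx => Ψ.eq_zero _ fun h => hx (by simpa using h 0))
  have hint := lintegral_mono (μ := (volume : Measure (Config n))) hY
  have hL1 : ∫⁻ Y : Config n, 6 * ∫⁻ x, (‖Ψ.ψ (Matrix.vecCons x Y)‖₊ : ℝ≥0∞) ^ 2 = 6 := by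
    rw [lintegral_const_mul' _ _ (by norm_num), ← lintegral_nnnorm_sq_eq_lintegral_vecCons hmeas,
      Ψ.norm_eq, mul_one]
  have hA : Measurable fun Y : Config n => ∫⁻ x, gradSqC (fun y => Ψ.ψ (Matrix.vecCons y Y)) x :=
    measurable_lintegral_gradSqC_vecCons hdiff
  have hB : Measurable fun Y : Config n =>
      (‖∫ x, (s x : ℂ) * Ψ.ψ (Matrix.vecCons x Y)‖₊ : ℝ≥0∞) ^ 2 :=
    (measurable_integral_mul_vecCons (Complex.continuous_ofReal.comp hsc)
      hcont).nnnorm.coe_nnreal_ennreal.pow_const 2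
  have hR : ∫⁻ Y : Config n, (ENNReal.ofReal ((L / Real.pi) ^ 2) *
      (∫⁻ x, gradSqC (fun y => Ψ.ψ (Matrix.vecCons y Y)) x) +
        3 * (‖∫ x, (s x : ℂ) * Ψ.ψ (Matrix.vecCons x Y)‖₊ : ℝ≥0∞) ^ 2) =
      ENNReal.ofReal ((L / Real.pi) ^ 2) * (∫⁻ X, partialGradSq 0 Ψ.ψ X) + 3 * T := by
    rw [lintegral_add_left (hA.const_mul _), lintegral_const_mul _ hA, lintegral_const_mul _ hB,
      lintegral_partialGradSq_zero_eq hdiff]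
  rw [hL1, hR] at hint
  -- kinetic energy through the first particle, and the energy budget
  have hkin : ((n : ℝ≥0∞) + 1) * ∫⁻ X, partialGradSq 0 Ψ.ψ X = energy 0 Ψ := by
    rw [← lintegral_kineticDensity_eq_mul hdiff Ψ.symm, energy]
    simp
  have hLq : (L / Real.pi) ^ 2 * (3 * Real.pi ^ 2 / L ^ 2) = 3 := by
    have hπ : Real.pi ≠ 0 := Real.pi_pos.ne'
    have hL0 : L ≠ 0 := hL.ne'
    field_simp
  have hN : ENNReal.ofReal ((n + 1 : ℕ) : ℝ) = (n : ℝ≥0∞) + 1 := by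
    rw [ENNReal.ofReal_natCast]; push_cast; rfl
  have hE : ENNReal.ofReal ((L / Real.pi) ^ 2) * energy 0 Ψ ≤
      3 * ((n : ℝ≥0∞) + 1) + 3 * (((n : ℝ≥0∞) + 1) * ENNReal.ofReal ε) := by
    calc ENNReal.ofReal ((L / Real.pi) ^ 2) * energy 0 Ψ
        ≤ ENNReal.ofReal ((L / Real.pi) ^ 2) * (ENNReal.ofReal (3 * Real.pi ^ 2 / L ^ 2 * ((n + 1 : ℕ) : ℝ)) +
            ENNReal.ofReal (3 * Real.pi ^ 2 / L ^ 2 * (((n + 1 : ℕ) : ℝ) * ε))) :=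
          mul_le_mul' le_rfl (hΨ.trans (add_le_add hUpper le_rfl))
      _ = ENNReal.ofReal (3 * ((n + 1 : ℕ) : ℝ)) + ENNReal.ofReal (3 * (((n + 1 : ℕ) : ℝ) * ε)) := by
          rw [mul_add, ← ENNReal.ofReal_mul (sq_nonneg _), ← ENNReal.ofReal_mul (sq_nonneg _), ← mul_assoc,
            hLq, ← mul_assoc, hLq]
      _ = 3 * ((n : ℝ≥0∞) + 1) + 3 * (((n : ℝ≥0∞) + 1) * ENNReal.ofReal ε) := by
          rw [ENNReal.ofReal_mul (by norm_num : (0 : ℝ) ≤ 3), ENNReal.ofReal_mul (by norm_num : (0 : ℝ) ≤ 3),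
            ENNReal.ofReal_mul (Nat.cast_nonneg _), hN, ENNReal.ofReal_ofNat]
  have h6 : 3 * ((n : ℝ≥0∞) + 1) + 3 * (((n : ℝ≥0∞) + 1) * 1) ≤
      3 * ((n : ℝ≥0∞) + 1) + 3 * (((n : ℝ≥0∞) + 1) * (ENNReal.ofReal ε + T)) := by
    calc 3 * ((n : ℝ≥0∞) + 1) + 3 * (((n : ℝ≥0∞) + 1) * 1) = ((n : ℝ≥0∞) + 1) * 6 := by ring
      _ ≤ ((n : ℝ≥0∞) + 1) * (ENNReal.ofReal ((L / Real.pi) ^ 2) * (∫⁻ X, partialGradSq 0 Ψ.ψ X) + 3 * T) :=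
          mul_le_mul' le_rfl hint
      _ = ENNReal.ofReal ((L / Real.pi) ^ 2) * (((n : ℝ≥0∞) + 1) * ∫⁻ X, partialGradSq 0 Ψ.ψ X) +
            3 * (((n : ℝ≥0∞) + 1) * T) := by ring
      _ ≤ 3 * ((n : ℝ≥0∞) + 1) + 3 * (((n : ℝ≥0∞) + 1) * ENNReal.ofReal ε) +
            3 * (((n : ℝ≥0∞) + 1) * T) := by rw [hkin]; exact add_le_add hE le_rfl
      _ = 3 * ((n : ℝ≥0∞) + 1) + 3 * (((n : ℝ≥0∞) + 1) * (ENNReal.ofReal ε + T)) := by ring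
  have hNtop : (n : ℝ≥0∞) + 1 ≠ ⊤ := ENNReal.add_ne_top.2 ⟨ENNReal.natCast_ne_top n, ENNReal.one_ne_top⟩
  have hN0 : (n : ℝ≥0∞) + 1 ≠ 0 := by positivity
  have h3top : 3 * ((n : ℝ≥0∞) + 1) ≠ ⊤ := ENNReal.mul_ne_top (by norm_num) hNtop
  have h7 := (ENNReal.add_le_add_iff_left h3top).1 h6
  have h8 := (ENNReal.mul_le_mul_iff_right (by norm_num) (by norm_num)).1 h7
  have h9 := (ENNReal.mul_le_mul_iff_right hN0 hNtop).1 h8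
  exact h9

/-- **Endgame arithmetic in `ℝ≥0∞`, with a free slack `t²`.** From `1 ≤ t² + T`, `∑R + T ≤ 1`,
`κ T^{1/2} ≤ S_V + S_W`, `S_W ≤ u (∑R)^{1/2}` and `κ ≥ κ₀ u` (`0 ≤ t ≤ 1`, `u, κ₀ ≥ 0`):
`S_V ≥ (κ₀(1 - t²) - t) u` (`T ≥ 1 - t²`, so `T^{1/2} ≥ 1 - t²`; `∑R ≤ t²`). [folklore] -/
theorem endgame_eps {T SR SV SW : ℝ≥0∞} {κ u κ₀ t : ℝ} (hu : 0 ≤ u) (hκ₀ : 0 ≤ κ₀) (ht0 : 0 ≤ t)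
    (ht1 : t ≤ 1) (hG : 1 ≤ ENNReal.ofReal (t ^ 2) + T)
    (hE : SR + T ≤ 1) (hM : ENNReal.ofReal κ * T ^ (1 / 2 : ℝ) ≤ SV + SW)
    (hCS : SW ≤ ENNReal.ofReal u * SR ^ (1 / 2 : ℝ)) (hκ : κ₀ * u ≤ κ) :
    ENNReal.ofReal ((κ₀ * (1 - t ^ 2) - t) * u) ≤ SV := by
  -- adapted from `endgame` (`Theorems/BECDyadicChainingBaseCoherentMassFreeBase.lean`)
  have hhalf : (0 : ℝ) ≤ 1 / 2 := by norm_num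
  have ht2 : t ^ 2 ≤ 1 := by nlinarith
  have ht2' : 0 ≤ 1 - t ^ 2 := by linarith
  have hTtop : T ≠ ⊤ := ne_top_of_le_ne_top ENNReal.one_ne_top (le_add_self.trans hE)
  have h1 : ENNReal.ofReal (t ^ 2) + ENNReal.ofReal (1 - t ^ 2) = 1 := by
    rw [← ENNReal.ofReal_add (sq_nonneg _) ht2', ← ENNReal.ofReal_one]
    congr 1
    ring
  have hT1 : ENNReal.ofReal (1 - t ^ 2) ≤ T :=
    (ENNReal.add_le_add_iff_left ENNReal.ofReal_ne_top).1 (h1.symm ▸ hG)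
  have hSR : SR ≤ ENNReal.ofReal (t ^ 2) := (ENNReal.add_le_add_iff_right hTtop).1 (hE.trans hG)
  have hT12 : ENNReal.ofReal (1 - t ^ 2) ≤ T ^ (1 / 2 : ℝ) := by
    refine le_trans ?_ (ENNReal.rpow_le_rpow hT1 hhalf)
    rw [ENNReal.ofReal_rpow_of_nonneg ht2' hhalf]
    exact ENNReal.ofReal_le_ofReal (Real.self_le_rpow_of_le_one ht2' (by linarith [sq_nonneg t]) (by norm_num))
  have hSR12 : SR ^ (1 / 2 : ℝ) ≤ ENNReal.ofReal t := by
    refine (ENNReal.rpow_le_rpow hSR hhalf).trans_eq ?_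
    rw [ENNReal.ofReal_rpow_of_nonneg (sq_nonneg _) hhalf, ← Real.sqrt_eq_rpow, Real.sqrt_sq ht0]
  have hκu0 : 0 ≤ κ₀ * u := mul_nonneg hκ₀ hu
  have hlow : ENNReal.ofReal (κ₀ * u * (1 - t ^ 2)) ≤ SV + ENNReal.ofReal (u * t) :=
    calc ENNReal.ofReal (κ₀ * u * (1 - t ^ 2)) = ENNReal.ofReal (κ₀ * u) * ENNReal.ofReal (1 - t ^ 2) :=
          ENNReal.ofReal_mul hκu0
      _ ≤ ENNReal.ofReal κ * T ^ (1 / 2 : ℝ) := mul_le_mul' (ENNReal.ofReal_le_ofReal hκ) hT12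
      _ ≤ SV + SW := hM
      _ ≤ SV + ENNReal.ofReal u * ENNReal.ofReal t := add_le_add le_rfl (hCS.trans (mul_le_mul' le_rfl hSR12))
      _ = SV + ENNReal.ofReal (u * t) := by rw [← ENNReal.ofReal_mul hu]
  have hsub : ENNReal.ofReal (κ₀ * u * (1 - t ^ 2) - u * t) ≤ SV := by
    rw [ENNReal.ofReal_sub _ (mul_nonneg hu ht0)]
    exact tsub_le_iff_right.2 hlow
  refine le_trans (ENNReal.ofReal_le_ofReal (le_of_eq ?_)) hsub
  ring

/-- **The coherent sum of a condensed state, at every level.** For a continuous real mode `s ≥ 0` on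
`[0,L)³` with `∫_{[0,L)³} s² = 1` and overlap `(s_K³)^{-1/2}∫_{[0,L)³} s ≥ κ₀·8^{K/2}` with the flat
modes of level `K`, every trial state with `⟨s, γ_Ψ s⟩ ≥ (1 - t²)N` (as `1 ≤ t² + ∫|∫ s Ψ(·,Y)|² dY`,
`0 ≤ t ≤ 1`, `t ≤ κ₀(1 - t²)`) has `cohSum_K(Ψ) ≥ (κ₀(1 - t²) - t)² N`: Minkowski in `L²(dY)` for the
Gram vectors `u_B = α_B u_s + w_B`, the slice estimate integrated in `Y` (`∑_B ‖w_B‖² ≤ t²`),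
Cauchy–Schwarz over the `8^K` cells (twice) and `cohSum_K = N ∑_B ‖u_B‖²`.
[cite: LSSY2005, §1.2 (1.17)] -/
theorem cohSum_ge_of_condensation {L : ℝ} (hL : 0 < L) {n : ℕ} (K : ℕ) {s : Space → ℝ}
    (hsc : Continuous s) (hs2 : IntegrableOn (fun x => ‖(s x : ℂ)‖ ^ 2) (cell L))
    (hs1 : ∫ x in cell L, ‖(s x : ℂ)‖ ^ 2 = 1) (hsi : IntegrableOn s (cell L))
    (hs0 : ∀ x ∈ cell L, 0 ≤ s x) {κ₀ t : ℝ} (hκ₀ : 0 ≤ κ₀) (ht0 : 0 ≤ t) (ht1 : t ≤ 1)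
    (hct : t ≤ κ₀ * (1 - t ^ 2))
    (hκ : κ₀ * Real.sqrt (8 ^ K) ≤ (Real.sqrt ((L / 2 ^ K) ^ 3))⁻¹ * ∫ x in cell L, s x)
    (Ψ : TrialState (n + 1) L)
    (hT : 1 ≤ ENNReal.ofReal (t ^ 2) +
      ∫⁻ Y : Config n, (‖∫ x, (s x : ℂ) * Ψ.ψ (Matrix.vecCons x Y)‖₊ : ℝ≥0∞) ^ 2) :
    ENNReal.ofReal ((κ₀ * (1 - t ^ 2) - t) ^ 2) * ((n + 1 : ℕ) : ℝ≥0∞) ≤ cohSum (n + 1) L K Ψ.ψ := by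
  -- adapted from `base_of_condensation` (`Theorems/BECDyadicChainingBaseCoherentMassFreeBase.lean`)
  have hcont : Continuous Ψ.ψ := Ψ.contDiff.continuous
  have hmeas : Measurable Ψ.ψ := hcont.measurable
  have hsC : Continuous fun x => (s x : ℂ) := Complex.continuous_ofReal.comp hsc
  have hhalf : (0 : ℝ) ≤ 1 / 2 := by norm_num
  -- notation
  set a : ℂ := ((Real.sqrt ((L / 2 ^ K) ^ 3))⁻¹ : ℂ) with ha
  set c : Config n → ℂ := fun Y => ∫ x, (s x : ℂ) * Ψ.ψ (Matrix.vecCons x Y) with hc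
  set α : (Fin 3 → Fin (2 ^ K)) → ℂ := fun i => a * ∫ x in dyCell L K i, (s x : ℂ) with hα
  set u : (Fin 3 → Fin (2 ^ K)) → Config n → ℂ := fun i Y =>
    ∫ x, conj (dyMode L K i x) * Ψ.ψ (Matrix.vecCons x Y) with hu
  set w : (Fin 3 → Fin (2 ^ K)) → Config n → ℂ := fun i Y =>
    a * (∫ x in dyCell L K i, Ψ.ψ (Matrix.vecCons x Y)) - α i * c Y with hw
  set T : ℝ≥0∞ := ∫⁻ Y, (‖c Y‖₊ : ℝ≥0∞) ^ 2 with hTdef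
  set R : (Fin 3 → Fin (2 ^ K)) → ℝ≥0∞ := fun i => ∫⁻ Y, (‖w i Y‖₊ : ℝ≥0∞) ^ 2 with hR
  set V : (Fin 3 → Fin (2 ^ K)) → ℝ≥0∞ := fun i => ∫⁻ Y, (‖u i Y‖₊ : ℝ≥0∞) ^ 2 with hV
  have hT' : 1 ≤ ENNReal.ofReal (t ^ 2) + T := hT
  -- measurability
  have hc_meas : Measurable c := measurable_integral_mul_vecCons hsC hcont
  have hw_meas : ∀ i, Measurable (w i) := fun i =>
    ((measurable_setIntegral_vecCons hmeas _).const_mul a).sub (hc_meas.const_mul _)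
  have hu_eq : ∀ i Y, u i Y = a * ∫ x in dyCell L K i, Ψ.ψ (Matrix.vecCons x Y) := fun i Y =>
    integral_conj_dyMode_mul L K i _
  have hu_meas : ∀ i, AEStronglyMeasurable (u i) volume := fun i => by
    rw [show u i = fun Y => a * ∫ x in dyCell L K i, Ψ.ψ (Matrix.vecCons x Y) from funext (hu_eq i)]
    exact ((measurable_setIntegral_vecCons hmeas _).const_mul _).aestronglyMeasurable
  -- (E) the slice estimate integrated over `Y`: `∑ R + T ≤ 1`
  have hBY : ∀ Y : Config n, (∑ i, (‖w i Y‖₊ : ℝ≥0∞) ^ 2) + (‖c Y‖₊ : ℝ≥0∞) ^ 2 ≤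
      ∫⁻ x, (‖Ψ.ψ (Matrix.vecCons x Y)‖₊ : ℝ≥0∞) ^ 2 := fun Y =>
    slice_error_le hL K hsc hs2 hs1 hsi (hcont.comp (continuous_id.matrixVecCons continuous_const))
      (HasCompactSupport.intro (isCompact_closedBall (0 : Space) (2 * L)) fun x hx =>
        Ψ.eq_zero _ fun h => hx (box_subset_closedBall L (by simpa using h 0)))
      (fun x hx => Ψ.eq_zero _ fun h => hx (by simpa using h 0))
  have hE : (∑ i, R i) + T ≤ 1 := by
    calc (∑ i, R i) + T = ∫⁻ Y, ((∑ i, (‖w i Y‖₊ : ℝ≥0∞) ^ 2) + (‖c Y‖₊ : ℝ≥0∞) ^ 2) := by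
          rw [lintegral_add_right _ (hc_meas.nnnorm.coe_nnreal_ennreal.pow_const 2),
            lintegral_finsetSum _ fun i _ => (hw_meas i).nnnorm.coe_nnreal_ennreal.pow_const 2]
      _ ≤ ∫⁻ Y, ∫⁻ x, (‖Ψ.ψ (Matrix.vecCons x Y)‖₊ : ℝ≥0∞) ^ 2 := lintegral_mono hBY
      _ = 1 := by rw [← lintegral_nnnorm_sq_eq_lintegral_vecCons hmeas, Ψ.norm_eq]
  -- (M) Minkowski for each cell, summed
  have hM : ∀ i, ‖α i‖ₑ * T ^ (1 / 2 : ℝ) ≤ (V i) ^ (1 / 2 : ℝ) + (R i) ^ (1 / 2 : ℝ) := fun i =>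
    enorm_mul_rpow_half_lintegral_le (hu_meas i) (hw_meas i).aestronglyMeasurable (α i) fun Y => by
      rw [hu_eq]; simp only [hw]; ring
  have hMsum : (∑ i, ‖α i‖ₑ) * T ^ (1 / 2 : ℝ) ≤ (∑ i, (V i) ^ (1 / 2 : ℝ)) + ∑ i, (R i) ^ (1 / 2 : ℝ) := by
    rw [Finset.sum_mul, ← Finset.sum_add_distrib]
    exact Finset.sum_le_sum fun i _ => hM i
  -- the overlap constant `∑ ‖α i‖ = (s_K³)^{-1/2} ∫_{[0,L)³} s`
  have hI0 : ∀ i, 0 ≤ ∫ x in dyCell L K i, s x := fun i =>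
    setIntegral_nonneg (measurableSet_dyCell L K i) fun x hx => hs0 x (dyCell_subset_cell L K i hx)
  have hα_norm : ∀ i, ‖α i‖ₑ = ENNReal.ofReal ((Real.sqrt ((L / 2 ^ K) ^ 3))⁻¹ * ∫ x in dyCell L K i, s x) := by
    intro i
    rw [← ofReal_norm]
    congr 1
    simp only [hα, ha]
    rw [integral_complex_ofReal, norm_mul, norm_inv, Complex.norm_real, Complex.norm_real,
      Real.norm_of_nonneg (Real.sqrt_nonneg _), Real.norm_of_nonneg (hI0 i)]
  have hU : ∫ x in cell L, s x = ∑ i, ∫ x in dyCell L K i, s x := by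
    rw [← integral_iUnion_fintype (fun i => measurableSet_dyCell L K i) (pairwise_disjoint_dyCell L K)
      (fun i => hsi.mono_set (dyCell_subset_cell L K i)), iUnion_dyCell]
    rfl
  have hsumα : ∑ i, ‖α i‖ₑ = ENNReal.ofReal ((Real.sqrt ((L / 2 ^ K) ^ 3))⁻¹ * ∫ x in cell L, s x) := by
    simp only [hα_norm]
    rw [← ENNReal.ofReal_sum_of_nonneg fun i _ => mul_nonneg (inv_nonneg.2 (Real.sqrt_nonneg _)) (hI0 i),
      ← Finset.mul_sum, hU]
  rw [hsumα] at hMsum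
  -- (CS) Cauchy–Schwarz over the `8^K` cells
  set ur : ℝ := Real.sqrt (8 ^ K) with hur
  have hur0 : 0 < ur := Real.sqrt_pos.2 (by positivity)
  have hcard : (Fintype.card (Fin 3 → Fin (2 ^ K)) : ℝ≥0∞) ^ (1 / 2 : ℝ) = ENNReal.ofReal ur := by
    rw [card_dyIndex, show ((8 ^ K : ℕ) : ℝ≥0∞) = ENNReal.ofReal ((8 : ℝ) ^ K) by
      rw [← ENNReal.ofReal_natCast]; push_cast; rfl,
      ENNReal.ofReal_rpow_of_nonneg (by positivity) hhalf, hur, Real.sqrt_eq_rpow]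
  have hCS : ∑ i, (R i) ^ (1 / 2 : ℝ) ≤ ENNReal.ofReal ur * (∑ i, R i) ^ (1 / 2 : ℝ) := by
    rw [← hcard]
    exact Summit.AtomisticToContinuum.BoseEinsteinCondensation.Cruxes.DyadicCoherenceDefect.Birth.LevelIncrement.sum_rpow_half_le R
  have hCSV : ∑ i, (V i) ^ (1 / 2 : ℝ) ≤ ENNReal.ofReal ur * (∑ i, V i) ^ (1 / 2 : ℝ) := by
    rw [← hcard]
    exact Summit.AtomisticToContinuum.BoseEinsteinCondensation.Cruxes.DyadicCoherenceDefect.Birth.LevelIncrement.sum_rpow_half_le V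
  -- endgame: `(κ₀(1-t²) - t)·8^{K/2} ≤ ∑ √V_i ≤ 8^{K/2} (∑ V_i)^{1/2}`
  set c₀ : ℝ := κ₀ * (1 - t ^ 2) - t with hc₀
  have hc₀0 : 0 ≤ c₀ := by rw [hc₀]; linarith
  have hSV : ENNReal.ofReal (c₀ * ur) ≤ ∑ i, (V i) ^ (1 / 2 : ℝ) :=
    endgame_eps hur0.le hκ₀ ht0 ht1 hT' hE hMsum hCS hκ
  have hsq : ENNReal.ofReal c₀ ≤ (∑ i, V i) ^ (1 / 2 : ℝ) := by
    have h1 : ENNReal.ofReal ur * ENNReal.ofReal c₀ ≤ ENNReal.ofReal ur * (∑ i, V i) ^ (1 / 2 : ℝ) := by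
      calc ENNReal.ofReal ur * ENNReal.ofReal c₀ = ENNReal.ofReal (c₀ * ur) := by
            rw [mul_comm, ENNReal.ofReal_mul hc₀0]
        _ ≤ ∑ i, (V i) ^ (1 / 2 : ℝ) := hSV
        _ ≤ ENNReal.ofReal ur * (∑ i, V i) ^ (1 / 2 : ℝ) := hCSV
    exact (ENNReal.mul_le_mul_iff_right (ENNReal.ofReal_pos.2 hur0).ne' ENNReal.ofReal_ne_top).1 h1
  have hV2 : ENNReal.ofReal (c₀ ^ 2) ≤ ∑ i, V i := by
    calc ENNReal.ofReal (c₀ ^ 2) = (ENNReal.ofReal c₀) ^ 2 := by rw [ENNReal.ofReal_pow hc₀0]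
      _ ≤ ((∑ i, V i) ^ (1 / 2 : ℝ)) ^ 2 := pow_le_pow_left₀ zero_le hsq 2
      _ = ∑ i, V i := by
          rw [← ENNReal.rpow_natCast, ← ENNReal.rpow_mul]
          norm_num
  -- conclusion: `cohSum = N · ∑ V_i`
  have hocc : ∀ i, occupation (n + 1) (dyMode L K i) Ψ.ψ = ((n : ℝ≥0∞) + 1) * V i := fun i => rfl
  have hcoh : cohSum (n + 1) L K Ψ.ψ = ((n : ℝ≥0∞) + 1) * ∑ i, V i := by
    simp only [cohSum, hocc, Finset.mul_sum]
  rw [hcoh, Nat.cast_succ, mul_comm]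
  exact mul_le_mul_right hV2 _

/-- **The overlap constant, sharpened.** `(s_K³)^{-1/2} ∫_{[0,L)³} s = 8^{K/2} (2√2/π)³ ≥ (18/25) 8^{K/2}`
(`s_K = L/2^K`; numerically `(2√2/π)³ = 0.7298…`, and `π < 3.15` gives `≥ 0.7239`).  Same proof as
`sineMode_overlap_ge` (constant `7/10`). [folklore] -/
theorem sineMode_overlap_ge' {L : ℝ} (hL : 0 < L) (K : ℕ) :
    18 / 25 * Real.sqrt (8 ^ K) ≤
      (Real.sqrt ((L / 2 ^ K) ^ 3))⁻¹ * (Real.sqrt (2 / L) * (2 * L / Real.pi)) ^ 3 := by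
  -- adapted from `sineMode_overlap_ge` (`Theorems/BECDyadicChainingBaseCoherentMassFreeBaseAux.lean`)
  have h2K : (0 : ℝ) < 2 ^ K := by positivity
  have hsK : 0 < (L / 2 ^ K) ^ 3 := by positivity
  have h8 : (8 : ℝ) ^ K = (2 ^ K) ^ 3 := by rw [← pow_mul, mul_comm, pow_mul]; norm_num
  set κ : ℝ := (Real.sqrt ((L / 2 ^ K) ^ 3))⁻¹ * (Real.sqrt (2 / L) * (2 * L / Real.pi)) ^ 3 with hκ
  have hκ0 : 0 ≤ κ := by positivity
  have hκ2 : κ ^ 2 * Real.pi ^ 6 = 512 * (2 ^ K) ^ 3 := by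
    have hπ : Real.pi ≠ 0 := Real.pi_pos.ne'
    have hL0 : L ≠ 0 := hL.ne'
    have h3 : ((Real.sqrt (2 / L) * (2 * L / Real.pi)) ^ 3) ^ 2 = ((2 / L) * (2 * L / Real.pi) ^ 2) ^ 3 := by
      rw [← pow_mul, mul_comm 3 2, pow_mul, mul_pow, Real.sq_sqrt (by positivity : (0 : ℝ) ≤ 2 / L)]
    rw [hκ, mul_pow, inv_pow, Real.sq_sqrt hsK.le, h3]
    field_simp
    ring
  have hπ6 : Real.pi ^ 6 < 3.15 ^ 6 := pow_lt_pow_left₀ Real.pi_lt_d2 Real.pi_pos.le (by norm_num)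
  have hle : (18 / 25 * Real.sqrt (8 ^ K)) ^ 2 ≤ κ ^ 2 := by
    have h1 : 512 * ((2 : ℝ) ^ K) ^ 3 ≤ κ ^ 2 * 3.15 ^ 6 := by
      rw [← hκ2]; exact mul_le_mul_of_nonneg_left hπ6.le (sq_nonneg κ)
    rw [mul_pow, Real.sq_sqrt (by positivity), h8]
    nlinarith [h1, pow_pos h2K 3]
  calc 18 / 25 * Real.sqrt (8 ^ K) = Real.sqrt ((18 / 25 * Real.sqrt (8 ^ K)) ^ 2) :=
        (Real.sqrt_sq (by positivity)).symm
    _ ≤ Real.sqrt (κ ^ 2) := Real.sqrt_le_sqrt hle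
    _ = κ := Real.sqrt_sq hκ0

/-- **Free near-minimisers are coarsely coherent at every level.** For `L > 0` and `N ≥ 1`, every
`Ψ ∈ TrialState N L` with `energy 0 Ψ ≤ E₀(0,N,L) + 10⁻⁶·3π²N/L²` has `cohSum N L K Ψ ≥ N/2` at every
dyadic level `K`: `condensation_of_nearMin_eps` (sine gap `stub_sineGap` + `stub_freeUpperBound`,
`t = 10⁻³`), `cohSum_ge_of_condensation` with the sine mode (`κ₀ = 18/25`, `sineMode_overlap_ge'`), and
`(18/25·(1 - 10⁻⁶) - 10⁻³)² ≥ 1/2`. [cite: LSSY2005, §1.2 (1.17)] -/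
theorem half_le_cohSum_of_free_nearMin {L : ℝ} (hL : 0 < L) {N : ℕ} (hN : 0 < N) (Ψ : TrialState N L)
    (hΨ : energy 0 Ψ ≤ groundStateEnergy 0 N L +
      ENNReal.ofReal (3 * Real.pi ^ 2 / L ^ 2 * ((N : ℝ) * (1 / 1000) ^ 2))) (K : ℕ) :
    ENNReal.ofReal ((N : ℝ) / 2) ≤ cohSum N L K Ψ.ψ := by
  obtain ⟨n, rfl⟩ : ∃ n, N = n + 1 := ⟨N - 1, by omega⟩
  have hT := condensation_of_nearMin_eps
    (s := fun x : Space => ∏ k : Fin 3, (Real.sqrt (2 / L) * Real.sin (Real.pi * x k / L)))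
    (by fun_prop) ((1 / 1000 : ℝ) ^ 2) (stub_sineGap L hL) (stub_freeUpperBound L hL (n + 1)) Ψ hΨ
  have h := cohSum_ge_of_condensation hL K (by fun_prop) (integrableOn_norm_sineMode_sq_cell L)
    (setIntegral_cell_norm_sineMode_sq hL) (integrableOn_sineMode_cell L)
    (fun x hx => sineMode_nonneg_of_mem_cell hL hx) (κ₀ := 18 / 25) (t := 1 / 1000) (by norm_num)
    (by norm_num) (by norm_num) (by norm_num)
    (by rw [setIntegral_cell_sineMode hL]; exact sineMode_overlap_ge' hL K) Ψ hT
  refine le_trans ?_ h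
  rw [div_eq_inv_mul, ENNReal.ofReal_mul (by norm_num : (0 : ℝ) ≤ 2⁻¹), ENNReal.ofReal_natCast]
  exact mul_le_mul_left (ENNReal.ofReal_le_ofReal (by norm_num)) _

end Summit.AtomisticToContinuum.BoseEinsteinCondensation.Theorems.BaseCoherentMass

/-! ## The registered stub -/

namespace Summit.AtomisticToContinuum.BoseEinsteinCondensation.Cruxes.TangentTransfer.Birth

open Literature.MathematicalPhysics.QuantumManyBody.BoseGas
open Summit.AtomisticToContinuum.BoseEinsteinCondensation.Theorems.BaseCoherentMass
  (half_le_cohSum_of_free_nearMin)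
open Summit.AtomisticToContinuum.BoseEinsteinCondensation.Cruxes.DyadicCoherenceDefect.Birth
  (stub_zeroScatteringEnergy)

/-- **STUB `stub_freeCoarse` — coarse coherence at level `0` for zero scattering length**
(registered signature of the line `registered`, skeleton v2, of the crux `TangentTransfer`).  For a
repulsive finite-range `v` with `scatteringLength v = 0` and `ρ > 0`: eventually in `N` (namely for
`N ≥ 1`), with `L = (N/ρ)^{1/3}` and `δ = 10⁻⁶·3π²N/L² > 0`, every `δ`-near-minimiser `Ψ` of the
Dirichlet energy has `ofReal (N/2) ≤ cohSum N L 0 Ψ`.  Zero scattering length means `v = 0` a.e., so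
`energy v = energy 0` and `E₀(v) = E₀(0)` (`stub_zeroScatteringEnergy`); then
`half_le_cohSum_of_free_nearMin` (sine gap, sharp free upper bound, Gram-vector geometry, overlap
`(2√2/π)³ ≥ 18/25`). [cite: LSSY2005, §1.2 (1.17) and App. C Thm. C.1] -/
theorem stub_freeCoarse :
    ∀ v : ℝ → ℝ≥0∞, IsRepulsiveFiniteRange v → scatteringLength v = 0 →
      ∀ ρ : ℝ, 0 < ρ → ∀ᶠ N : ℕ in atTop, ∃ δ : ℝ≥0∞, 0 < δ ∧
        ∀ Ψ : TrialState N (sideLength ρ N),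
          energy v Ψ ≤ groundStateEnergy v N (sideLength ρ N) + δ →
            ENNReal.ofReal ((N : ℝ) / 2) ≤ cohSum N (sideLength ρ N) 0 Ψ.ψ := by
  intro v hv h0 ρ hρ
  filter_upwards [eventually_gt_atTop 0] with N hN
  have hL : 0 < sideLength ρ N := Real.rpow_pos_of_pos (div_pos (Nat.cast_pos.2 hN) hρ) _
  have hEv : ∀ Ψ : TrialState N (sideLength ρ N), energy v Ψ = energy 0 Ψ :=
    stub_zeroScatteringEnergy v hv h0 N (sideLength ρ N)
  have hGS : groundStateEnergy v N (sideLength ρ N) = groundStateEnergy 0 N (sideLength ρ N) := by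
    unfold groundStateEnergy
    exact iInf_congr hEv
  refine ⟨ENNReal.ofReal (3 * Real.pi ^ 2 / sideLength ρ N ^ 2 * ((N : ℝ) * (1 / 1000) ^ 2)),
    ENNReal.ofReal_pos.2 (by positivity), fun Ψ hΨ => ?_⟩
  rw [hEv, hGS] at hΨ
  exact half_le_cohSum_of_free_nearMin hL hN Ψ hΨ 0

end Summit.AtomisticToContinuum.BoseEinsteinCondensation.Cruxes.TangentTransfer.Birth

end
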